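import Summits.MatrixMultiplication.OmegaCensus.STPPVosperSlackOneTwoWindowsTable

/-!
# ω-census (abelian STPP census): two windows — the case-β₂ TRANSPORT for a block with `b = 2` (kernel)

HONEST FRAMING (pub-omega census; verbatim): lottery ticket; floor = certified bounds/negative ranges.
Census STRUCTURE (seat pub-omega-stpp-1 gen 30, 2026-08-28), family (b2).  Tools for the slack-1 Vosper law at a block with `b = |Bᵢ| = 2` in case β
(`|Bᵢ + V| = |V| + 2`): `Bᵢ = {β, β + e′}`, so the two-run structure (`two_runs_of_card_union_vadd`) makes `V = W ⊔ (Sn + Y°)` the union of TWO maximal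
`e′`-runs `V₁ ⊔ V₂`; transported by `x ↦ e′⁻¹(x − v₁)` they become the windows `[0, n₁)` and `s₂ + [0, n₂)`; the blocks of `W` are PAIRS `{g, g+1}`, each
inside one window (the successor of each window's last point is outside `V`), so the prefix law with run length `2` holds separately in each window for the
points of the progression `Sn + Y°`.  Nothing here is progress on `ω`.

## Contents

* `prefixOK_two_of_pairs` — prefix law in one window tiled by pairs; `two_windows_ratio_val_mem` — the transport-and-table step of case β₂
  (the table `tableBeta2` and its meaning are in `STPPVosperSlackOneTwoWindowsTable.lean`).

References: A. G. Vosper, J. London Math. Soc. 31 (1956); M. B. Nathanson, GTM 165, §2.5; H. Cohn, R. Kleinberg, B. Szegedy, C. Umans, FOCS 2005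
(arXiv:math/0511460), Def. 5.1.
-/

open Finset
open scoped Pointwise

namespace Summit.MatrixMultiplication.OmegaCensus.CubeNB

open Literature.Computability.AlgebraicComplexity
open Literature.Combinatorics.Additive
open Summit.MatrixMultiplication.OmegaCensus.STPPKneser

/-! ## §3 The two-window transport (case β₂) -/

section Transport

variable {p : ℕ} [hp : Fact p.Prime] {N : ℕ} {A B C : Fin N → Finset (ZMod p)}

/-- Prefix law in one window for pairs: if `I = T' ⊔ S'` is the window `{0,…,n'−1}` (`n' + 1 ≤ p`), `T'` a disjoint union of pairs `{g, g+1}` indexed by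
`Q`, then `prefixOK 2 (val(S'))`. [folklore] -/
theorem prefixOK_two_of_pairs {Q : Finset (ZMod p × ZMod p)} {g : ZMod p × ZMod p → ZMod p} {n' : ℕ} (hn' : n' + 1 ≤ p)
    {S' : Finset (ZMod p)} (hdisj : (Q : Set (ZMod p × ZMod p)).PairwiseDisjoint fun xc => apFinset (g xc) 1 2)
    (hU : (Q.biUnion fun xc => apFinset (g xc) 1 2) ∪ S' = apFinset 0 1 n')
    (hTS : Disjoint (Q.biUnion fun xc => apFinset (g xc) 1 2) S') :
    prefixOK 2 (S'.image ZMod.val) = true := by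
  have hn : n' ≤ p := by omega
  have hTsub : ∀ xc ∈ Q, apFinset (g xc) 1 2 ⊆ apFinset 0 1 n' := by
    intro xc hxc y hy
    rw [← hU]
    exact mem_union_left _ (mem_biUnion.2 ⟨xc, hxc, hy⟩)
  apply prefixOK_of_val rfl
  intro x hxS
  have hxT : x ∉ Q.biUnion (fun xc => apFinset (g xc) 1 2) := fun hxT => Finset.disjoint_left.1 hTS hxT hxS
  have hxle : x.val ≤ n' := ((mem_apFinset_zero_one_iff hn).1 (by rw [← hU]; exact mem_union_right _ hxS)).le
  have h4 : 2 ∣ #((Q.biUnion fun xc => apFinset (g xc) 1 2).filter fun y => y.val < x.val) :=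
    dvd_card_filter_val_lt_prime Q g (by omega) hdisj hTsub x hxT
  rw [(card_filter_val_lt_of_union_prime hn hU hTS hxle).2] at h4
  exact h4

/-- **Two windows** (case β₂, the transport-and-table step).  `Bᵢ = {β, β + e′}` (`e′ ≠ 0`), `V = W ⊔ SY = V₁ ∪ V₂` with `V_k` the `n_k`-term progression
of step `e′` from `v_k`, `n₁ + n₂ = |V|`, the successors `v_k + n_k e′ ∉ V`, `SY` the `m`-term progression of step `d ≠ 0` from `c₀`, `|V| + 2 ≤ p`, `n₁ ≥ 1`;
then the case-β₂ table for `(p, |V|, m)` with target `J` gives `(e′⁻¹ d).val ∈ J`. [folklore] -/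
theorem two_windows_ratio_val_mem (hS : IsSTPP A B C) (i : Fin N) {e' β v₁ v₂ d c₀ : ZMod p} {n₁ n₂ m : ℕ} (he' : e' ≠ 0) (hd : d ≠ 0)
    (hm : m ≤ p)
    (hB : B i = apFinset β e' 2) {SY : Finset (ZMod p)} (hSY : SY = apFinset c₀ d m)
    (hWV : Disjoint ((((A i) ×ˢ ((B i) ×ˢ (C i))).image fun q : ZMod p × ZMod p × ZMod p => (0 : ZMod p) + q.2.2 - q.1 - q.2.1)) SY)
    (hV : (((A i) ×ˢ ((B i) ×ˢ (C i))).image fun q : ZMod p × ZMod p × ZMod p => (0 : ZMod p) + q.2.2 - q.1 - q.2.1) ∪ SY =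
      apFinset v₁ e' n₁ ∪ apFinset v₂ e' n₂)
    (hVcard : #((((A i) ×ˢ ((B i) ×ˢ (C i))).image fun q : ZMod p × ZMod p × ZMod p => (0 : ZMod p) + q.2.2 - q.1 - q.2.1) ∪ SY) = n₁ + n₂)
    (hend₁ : v₁ + n₁ • e' ∉ apFinset v₁ e' n₁ ∪ apFinset v₂ e' n₂) (hend₂ : v₂ + n₂ • e' ∉ apFinset v₁ e' n₁ ∪ apFinset v₂ e' n₂)
    (hnp : n₁ + n₂ + 2 ≤ p) (hn1 : 1 ≤ n₁) (hn2 : 1 ≤ n₂) {J : Finset ℕ}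
    (htable : ∀ j < p, ∀ t < p, ∀ n₁', 1 ≤ n₁' → n₁' < n₁ + n₂ → n₁' ≤ oddMinL p (n₁ + n₂) m (posList p m j t) →
      n₁' ∉ (range m).image (fun k => (t + j * k) % p) →
      (n₁' + #((range m).filter fun k => (t + j * k) % p < n₁')) % 2 = 0 →
      prefixOK 2 (((range m).filter fun k => (t + j * k) % p < n₁').image fun k => (t + j * k) % p) = true →
      ∀ s < p, (∀ k < m, (t + j * k) % p < n₁' ∨ ((t + j * k) % p + p - s) % p < n₁ + n₂ - n₁') →
      (∀ i < n₁ + n₂ - n₁', n₁' ≤ (s + i) % p) → n₁ + n₂ - n₁' ≤ (n₁' + p - s) % p → n₁' ≤ (s + (n₁ + n₂ - n₁')) % p →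
      prefixOK 2 (((range m).filter fun k => ((t + j * k) % p + p - s) % p < n₁ + n₂ - n₁').image fun k => ((t + j * k) % p + p - s) % p) = true →
      j ∈ J) :
    (e'⁻¹ * d).val ∈ J := by
  set W := ((A i) ×ˢ ((B i) ×ˢ (C i))).image fun q : ZMod p × ZMod p × ZMod p => (0 : ZMod p) + q.2.2 - q.1 - q.2.1 with hW
  obtain ⟨hWeq0, hPdisj0⟩ := W_eq_biUnion_blocks hS i
  rw [← hW] at hWeq0
  set P := (A i) ×ˢ (C i) with hP
  have hblk : ∀ xc : ZMod p × ZMod p, (B i).image (fun y => (xc.2 - xc.1) - y) = apFinset (xc.2 - xc.1 - β - 1 • e') e' 2 := by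
    intro xc; rw [hB, image_sub_apFinset]
  -- transport
  set u : ZMod p := e'⁻¹ with hu
  set w : ZMod p := -(u * v₁) with hw
  have hu0 : u ≠ 0 := inv_ne_zero he'
  have hue : u * e' = 1 := inv_mul_cancel₀ he'
  have hφinj : Function.Injective (fun x : ZMod p => u * x + w) := affine_injective hu0 w
  set I₁ := apFinset (0 : ZMod p) 1 n₁ with hI₁
  set s₂ : ZMod p := u * v₂ + w with hs₂
  set I₂ := apFinset s₂ 1 n₂ with hI₂
  have hφV₁ : (apFinset v₁ e' n₁).image (fun x => u * x + w) = I₁ := by rw [image_affine_apFinset, hue, hw, add_neg_cancel]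
  have hφV₂ : (apFinset v₂ e' n₂).image (fun x => u * x + w) = I₂ := by rw [image_affine_apFinset, hue]
  set g : ZMod p × ZMod p → ZMod p := fun xc => u * (xc.2 - xc.1 - β - 1 • e') + w with hg
  have hφblk : ∀ xc : ZMod p × ZMod p, ((B i).image fun y => (xc.2 - xc.1) - y).image (fun x => u * x + w) = apFinset (g xc) 1 2 := by
    intro xc; rw [hblk, image_affine_apFinset, hue]
  set T := W.image (fun x => u * x + w) with hT
  have hTeq : T = P.biUnion fun xc => apFinset (g xc) 1 2 := by
    rw [hT, hWeq0, Finset.biUnion_image]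
    exact Finset.biUnion_congr rfl fun xc _ => hφblk xc
  have hTdisj : (P : Set (ZMod p × ZMod p)).PairwiseDisjoint fun xc => apFinset (g xc) 1 2 := by
    intro xc hxc xc' hxc' hne
    rw [Function.onFun, ← hφblk, ← hφblk]
    exact (Finset.disjoint_image hφinj).2 (hPdisj0 hxc hxc' hne)
  set S := SY.image (fun x => u * x + w) with hSdef
  set t' : ZMod p := u * c₀ + w with ht'
  set j' : ZMod p := u * d with hj'
  have hSeq : S = apFinset t' j' m := by rw [hSdef, hSY, image_affine_apFinset]
  have hV' : T ∪ S = I₁ ∪ I₂ := by rw [hT, hSdef, ← Finset.image_union, hV, Finset.image_union, hφV₁, hφV₂]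
  have hTSdisj : Disjoint T S := by rw [hT, hSdef]; exact (Finset.disjoint_image hφinj).2 hWV
  have hn₁p : n₁ ≤ p := by omega
  have hn₂p : n₂ ≤ p := by omega
  have hI₁card : #I₁ = n₁ := card_apFinset one_ne_zero hn₁p
  have hI₂card : #I₂ = n₂ := card_apFinset one_ne_zero hn₂p
  have hVimg : (apFinset v₁ e' n₁ ∪ apFinset v₂ e' n₂).image (fun x => u * x + w) = I₁ ∪ I₂ := by
    rw [Finset.image_union, hφV₁, hφV₂]
  have hI12 : Disjoint I₁ I₂ := by
    rw [Finset.disjoint_iff_inter_eq_empty, ← Finset.card_eq_zero]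
    have h1 : #(I₁ ∪ I₂) = n₁ + n₂ := by rw [← hVimg, ← hV, Finset.card_image_of_injective _ hφinj, hVcard]
    have h2 := Finset.card_union_add_card_inter I₁ I₂
    omega
  -- the two ends, transported
  have hendI : ((n₁ : ℕ) : ZMod p) ∉ I₁ ∪ I₂ := by
    have hφe : (fun x => u * x + w) (v₁ + n₁ • e') = ((n₁ : ℕ) : ZMod p) := by
      show u * (v₁ + n₁ • e') + w = n₁
      rw [hw, nsmul_eq_mul]; linear_combination (n₁ : ZMod p) * hue
    rw [← hφe, ← hVimg, hφinj.mem_finset_image]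
    exact hend₁
  have hendI₂ : s₂ + n₂ • (1 : ZMod p) ∉ I₁ ∪ I₂ := by
    have hφe : (fun x => u * x + w) (v₂ + n₂ • e') = s₂ + n₂ • (1 : ZMod p) := by
      show u * (v₂ + n₂ • e') + w = s₂ + n₂ • 1
      rw [hs₂, nsmul_eq_mul, nsmul_eq_mul]; linear_combination (n₂ : ZMod p) * hue
    rw [← hφe, ← hVimg, hφinj.mem_finset_image]
    exact hend₂
  -- each pair lies inside one window
  have hTsub : ∀ xc ∈ P, apFinset (g xc) 1 2 ⊆ I₁ ∪ I₂ := by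
    intro xc hxc y hy
    rw [← hV', hTeq]
    exact mem_union_left _ (mem_biUnion.2 ⟨xc, hxc, hy⟩)
  have hg0 : ∀ xc, g xc ∈ apFinset (g xc) 1 2 := fun xc => mem_apFinset.2 ⟨0, by omega, by simp⟩
  have hg1 : ∀ xc, g xc + 1 ∈ apFinset (g xc) 1 2 := fun xc => mem_apFinset.2 ⟨1, by omega, by simp⟩
  have hpair : ∀ xc, apFinset (g xc) 1 2 = {g xc, g xc + 1} := by
    intro xc; rw [pair_eq_apFinset]
  have hin₁ : ∀ xc ∈ P, g xc ∈ I₁ → apFinset (g xc) 1 2 ⊆ I₁ := by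
    intro xc hxc hgI y hy
    rw [hpair, mem_insert, mem_singleton] at hy
    rcases hy with rfl | rfl
    · exact hgI
    · have hgv : (g xc).val < n₁ := (mem_apFinset_zero_one_iff hn₁p).1 hgI
      by_cases hlt : (g xc).val + 1 < n₁
      · refine (mem_apFinset_zero_one_iff hn₁p).2 ?_
        rw [ZMod.val_add, ZMod.val_one, Nat.mod_eq_of_lt (by omega)]; exact hlt
      · exfalso
        apply hendI
        have heq : g xc + 1 = ((n₁ : ℕ) : ZMod p) := by
          have : n₁ = (g xc).val + 1 := by omega
          rw [this, Nat.cast_add, Nat.cast_one, ZMod.natCast_zmod_val]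
        rw [← heq]
        exact hTsub xc hxc (hg1 xc)
  have hin₂ : ∀ xc ∈ P, g xc ∈ I₂ → apFinset (g xc) 1 2 ⊆ I₂ := by
    intro xc hxc hgI y hy
    rw [hpair, mem_insert, mem_singleton] at hy
    rcases hy with rfl | rfl
    · exact hgI
    · obtain ⟨i₀, hi₀, hgi⟩ := mem_apFinset.1 hgI
      by_cases hlt : i₀ + 1 < n₂
      · exact mem_apFinset.2 ⟨i₀ + 1, hlt, by rw [← hgi, succ_nsmul]; abel⟩
      · exfalso
        apply hendI₂
        have heq : g xc + 1 = s₂ + n₂ • (1 : ZMod p) := by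
          have : n₂ = i₀ + 1 := by omega
          rw [this, ← hgi, succ_nsmul]; abel
        rw [← heq]
        exact hTsub xc hxc (hg1 xc)
  -- split T and S by windows
  set P₁ := P.filter (fun xc => g xc ∈ I₁) with hP₁
  set P₂ := P.filter (fun xc => g xc ∈ I₂) with hP₂
  set T₁ := P₁.biUnion fun xc => apFinset (g xc) 1 2 with hT₁
  set T₂ := P₂.biUnion fun xc => apFinset (g xc) 1 2 with hT₂
  set S₁ := S.filter (fun x => x ∈ I₁) with hS₁
  set S₂ := S.filter (fun x => x ∈ I₂) with hS₂
  have hT₁I : T₁ ⊆ I₁ := by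
    intro y hy
    obtain ⟨xc, hxc, hy⟩ := mem_biUnion.1 hy
    exact hin₁ xc (mem_filter.1 hxc).1 (mem_filter.1 hxc).2 hy
  have hT₂I : T₂ ⊆ I₂ := by
    intro y hy
    obtain ⟨xc, hxc, hy⟩ := mem_biUnion.1 hy
    exact hin₂ xc (mem_filter.1 hxc).1 (mem_filter.1 hxc).2 hy
  have hTsplit : T ⊆ T₁ ∪ T₂ := by
    intro y hy
    rw [hTeq] at hy
    obtain ⟨xc, hxc, hy⟩ := mem_biUnion.1 hy
    rcases mem_union.1 (hTsub xc hxc (hg0 xc)) with h1 | h2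
    · exact mem_union_left _ (mem_biUnion.2 ⟨xc, mem_filter.2 ⟨hxc, h1⟩, hy⟩)
    · exact mem_union_right _ (mem_biUnion.2 ⟨xc, mem_filter.2 ⟨hxc, h2⟩, hy⟩)
  have hU₁ : T₁ ∪ S₁ = I₁ := by
    apply Finset.Subset.antisymm (union_subset hT₁I (fun x hx => (mem_filter.1 hx).2))
    intro x hxI
    have hx : x ∈ T ∪ S := by rw [hV']; exact mem_union_left _ hxI
    rcases mem_union.1 hx with hxT | hxS
    · rcases mem_union.1 (hTsplit hxT) with h1 | h2
      · exact mem_union_left _ h1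
      · exact absurd (mem_inter.2 ⟨hxI, hT₂I h2⟩) (by rw [Finset.disjoint_iff_inter_eq_empty.1 hI12]; simp)
    · exact mem_union_right _ (mem_filter.2 ⟨hxS, hxI⟩)
  have hU₂ : T₂ ∪ S₂ = I₂ := by
    apply Finset.Subset.antisymm (union_subset hT₂I (fun x hx => (mem_filter.1 hx).2))
    intro x hxI
    have hx : x ∈ T ∪ S := by rw [hV']; exact mem_union_right _ hxI
    rcases mem_union.1 hx with hxT | hxS
    · rcases mem_union.1 (hTsplit hxT) with h1 | h2
      · exact absurd (mem_inter.2 ⟨hT₁I h1, hxI⟩) (by rw [Finset.disjoint_iff_inter_eq_empty.1 hI12]; simp)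
      · exact mem_union_left _ h2
    · exact mem_union_right _ (mem_filter.2 ⟨hxS, hxI⟩)
  have hdisj₁ : (P₁ : Set (ZMod p × ZMod p)).PairwiseDisjoint fun xc => apFinset (g xc) 1 2 :=
    hTdisj.subset (Finset.coe_subset.2 (Finset.filter_subset _ _))
  have hdisj₂ : (P₂ : Set (ZMod p × ZMod p)).PairwiseDisjoint fun xc => apFinset (g xc) 1 2 :=
    hTdisj.subset (Finset.coe_subset.2 (Finset.filter_subset _ _))
  have hTS₁ : Disjoint T₁ S₁ := by
    refine Finset.disjoint_of_subset_left ?_ (Finset.disjoint_of_subset_right (Finset.filter_subset _ _) hTSdisj)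
    intro y hy; exact (hTsplit.trans (by rfl : T₁ ∪ T₂ ⊆ T₁ ∪ T₂)) |> fun _ => by
      rw [hTeq]; obtain ⟨xc, hxc, hy⟩ := mem_biUnion.1 hy; exact mem_biUnion.2 ⟨xc, (mem_filter.1 hxc).1, hy⟩
  have hTS₂ : Disjoint T₂ S₂ := by
    refine Finset.disjoint_of_subset_left ?_ (Finset.disjoint_of_subset_right (Finset.filter_subset _ _) hTSdisj)
    intro y hy
    rw [hTeq]; obtain ⟨xc, hxc, hy⟩ := mem_biUnion.1 hy; exact mem_biUnion.2 ⟨xc, (mem_filter.1 hxc).1, hy⟩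
  -- window 1
  have hpre₁ : prefixOK 2 (S₁.image ZMod.val) = true := prefixOK_two_of_pairs (by omega : n₁ + 1 ≤ p) hdisj₁ hU₁ hTS₁
  -- window 2, translated by −s₂
  have himg_add : ∀ (c a e : ZMod p) (k : ℕ), (apFinset a e k).image (fun x => x + c) = apFinset (a + c) e k := by
    intro c a e k
    have h := image_affine_apFinset 1 c a e k
    simp only [one_mul] at h
    exact h
  set ψ : ZMod p → ZMod p := fun x => x + -s₂ with hψ
  have hψinj : Function.Injective ψ := add_left_injective (-s₂)
  have hψI₂ : I₂.image ψ = apFinset 0 1 n₂ := by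
    rw [hI₂, hψ, himg_add, add_neg_cancel]
  have hψT₂ : T₂.image ψ = P₂.biUnion fun xc => apFinset (ψ (g xc)) 1 2 := by
    rw [hT₂, Finset.biUnion_image]
    apply Finset.biUnion_congr rfl
    intro xc _
    rw [hψ, himg_add]
  have hdisjψ : (P₂ : Set (ZMod p × ZMod p)).PairwiseDisjoint fun xc => apFinset (ψ (g xc)) 1 2 := by
    intro xc hxc xc' hxc' hne
    have h := (Finset.disjoint_image hψinj).2 (hdisj₂ hxc hxc' hne)
    rw [Function.onFun]
    rw [hψ, himg_add, himg_add] at h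
    exact h
  have hUψ : (P₂.biUnion fun xc => apFinset (ψ (g xc)) 1 2) ∪ S₂.image ψ = apFinset 0 1 n₂ := by
    rw [← hψT₂, ← Finset.image_union, hU₂, hψI₂]
  have hTSψ : Disjoint (P₂.biUnion fun xc => apFinset (ψ (g xc)) 1 2) (S₂.image ψ) := by
    rw [← hψT₂]; exact (Finset.disjoint_image hψinj).2 hTS₂
  have hpre₂ : prefixOK 2 ((S₂.image ψ).image ZMod.val) = true := prefixOK_two_of_pairs (by omega : n₂ + 1 ≤ p) hdisjψ hUψ hTSψ
  -- values
  have hposval : ∀ k, (t' + k • j').val = (t'.val + j'.val * k) % p := fun k => val_add_nsmul_zmod t' j' k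
  have hval_sub : ∀ x : ZMod p, (x - s₂).val = (x.val + p - s₂.val) % p := by
    intro x
    by_cases hs : s₂ = 0
    · rw [hs, sub_zero, ZMod.val_zero, Nat.sub_zero, Nat.add_mod_right, Nat.mod_eq_of_lt (ZMod.val_lt x)]
    · rw [sub_eq_add_neg, ZMod.val_add, ZMod.neg_val, if_neg hs]
      have := ZMod.val_lt s₂
      rw [show x.val + (p - s₂.val) = x.val + p - s₂.val by omega]
  have hmemI₂ : ∀ x : ZMod p, x ∈ I₂ ↔ (x - s₂).val < n₂ := by
    intro x
    rw [← mem_apFinset_zero_one_iff hn₂p, hI₂, mem_apFinset, mem_apFinset]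
    constructor
    · rintro ⟨i, hi, rfl⟩; exact ⟨i, hi, by simp⟩
    · rintro ⟨i, hi, h⟩; exact ⟨i, hi, by rw [zero_add] at h; rw [h]; abel⟩
  have hψval : ∀ x : ZMod p, (ψ x).val = (x.val + p - s₂.val) % p := by
    intro x; rw [hψ]; show (x + -s₂).val = _; rw [← sub_eq_add_neg, hval_sub]
  have hSimg : S = (range m).image fun k => t' + k • j' := by rw [hSeq]; rfl
  have hPS₁ : S₁.image ZMod.val = ((range m).filter fun k => (t'.val + j'.val * k) % p < n₁).image fun k => (t'.val + j'.val * k) % p := by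
    rw [hS₁, hSimg, Finset.filter_image, Finset.image_image]
    have hf : (range m).filter (fun k => t' + k • j' ∈ I₁) = (range m).filter fun k => (t'.val + j'.val * k) % p < n₁ := by
      apply Finset.filter_congr
      intro k _
      rw [mem_apFinset_zero_one_iff hn₁p, hposval]
    rw [hf]
    exact Finset.image_congr fun k _ => by show (t' + k • j').val = _; exact hposval k
  have hPS₂ : (S₂.image ψ).image ZMod.val =
      ((range m).filter fun k => ((t'.val + j'.val * k) % p + p - s₂.val) % p < n₂).image fun k => ((t'.val + j'.val * k) % p + p - s₂.val) % p := by
    rw [hS₂, hSimg, Finset.filter_image, Finset.image_image, Finset.image_image]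
    have hf : (range m).filter (fun k => t' + k • j' ∈ I₂) =
        (range m).filter fun k => ((t'.val + j'.val * k) % p + p - s₂.val) % p < n₂ := by
      apply Finset.filter_congr
      intro k _
      rw [hmemI₂, hval_sub, hposval]
    rw [hf]
    exact Finset.image_congr fun k _ => by show (ψ (t' + k • j')).val = _; rw [hψval, hposval]
  rw [hPS₁] at hpre₁
  rw [hPS₂] at hpre₂
  -- the table
  have hSsub : S ⊆ I₁ ∪ I₂ := by rw [← hV']; exact subset_union_right
  have hn1pos : n₁ ∉ (range m).image (fun k => (t'.val + j'.val * k) % p) := by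
    intro hmem
    obtain ⟨k, hk, hkx⟩ := Finset.mem_image.1 hmem
    apply hendI
    have : ((n₁ : ℕ) : ZMod p) = t' + k • j' := by
      apply ZMod.val_injective p
      rw [hposval, hkx, ZMod.val_natCast, Nat.mod_eq_of_lt (by omega)]
    rw [this]
    exact hSsub (by rw [hSimg]; exact mem_image_of_mem _ hk)
  have hcov : ∀ k < m, (t'.val + j'.val * k) % p < n₁ ∨ ((t'.val + j'.val * k) % p + p - s₂.val) % p < n₁ + n₂ - n₁ := by
    intro k hk
    have hx : t' + k • j' ∈ I₁ ∪ I₂ := hSsub (by rw [hSimg]; exact mem_image_of_mem _ (mem_range.2 hk))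
    rcases mem_union.1 hx with h1 | h2
    · left; rw [← hposval]; exact (mem_apFinset_zero_one_iff hn₁p).1 h1
    · right; rw [← hposval, ← hval_sub, show n₁ + n₂ - n₁ = n₂ by omega]; exact (hmemI₂ _).1 h2
  have hdisjN : ∀ i < n₁ + n₂ - n₁, n₁ ≤ (s₂.val + i) % p := by
    intro i hi
    have hmem : s₂ + i • (1 : ZMod p) ∈ I₂ := mem_apFinset.2 ⟨i, by omega, rfl⟩
    have hnot : s₂ + i • (1 : ZMod p) ∉ I₁ := fun h => Finset.disjoint_left.1 hI12 h hmem
    rw [mem_apFinset_zero_one_iff hn₁p, not_lt, val_add_nsmul_zmod, ZMod.val_one, one_mul] at hnot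
    exact hnot
  have hn1I2 : n₁ + n₂ - n₁ ≤ (n₁ + p - s₂.val) % p := by
    have hnot : ((n₁ : ℕ) : ZMod p) ∉ I₂ := fun h => hendI (mem_union_right _ h)
    rw [hmemI₂, not_lt, hval_sub, ZMod.val_natCast, Nat.mod_eq_of_lt (by omega : n₁ < p)] at hnot
    rwa [show n₁ + n₂ - n₁ = n₂ by omega]
  have hendN : n₁ ≤ (s₂.val + (n₁ + n₂ - n₁)) % p := by
    have hnot : s₂ + n₂ • (1 : ZMod p) ∉ I₁ := fun h => hendI₂ (mem_union_left _ h)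
    rw [mem_apFinset_zero_one_iff hn₁p, not_lt, val_add_nsmul_zmod, ZMod.val_one, one_mul] at hnot
    rwa [show n₁ + n₂ - n₁ = n₂ by omega]
  -- parity of window 1: n₁ = |T₁| + |S₁| with |T₁| even
  have hj'0 : j' ≠ 0 := mul_ne_zero hu0 hd
  have hpar : (n₁ + #((range m).filter fun k => (t'.val + j'.val * k) % p < n₁)) % 2 = 0 := by
    have hS₁card : #S₁ = #((range m).filter fun k => (t'.val + j'.val * k) % p < n₁) := by
      have h := congrArg Finset.card hPS₁
      rw [Finset.card_image_of_injective _ (ZMod.val_injective p)] at h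
      rw [h, Finset.card_image_of_injOn]
      intro k hk k' hk' hkk
      have hkm := Finset.mem_range.1 (Finset.mem_filter.1 (Finset.mem_coe.1 hk)).1
      have hkm' := Finset.mem_range.1 (Finset.mem_filter.1 (Finset.mem_coe.1 hk')).1
      refine zmod_natMul_injOn (t := t') hj'0 (by omega) (by omega) ?_
      apply ZMod.val_injective p
      rw [hposval, hposval]; exact hkk
    have hT₁card : #T₁ = 2 * #P₁ := by
      rw [hT₁, Finset.card_biUnion (fun xc hxc xc' hxc' hne => hdisj₁ hxc hxc' hne)]
      rw [Finset.sum_const_nat (fun xc _ => card_apFinset one_ne_zero (by omega : 2 ≤ p)), mul_comm]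
    have hI : #I₁ = #T₁ + #S₁ := by rw [← hU₁, card_union_of_disjoint hTS₁]
    rw [hI₁card] at hI
    rw [← hS₁card]; omega
  -- the bound n₁ ≤ oddMin: every position below n₁ has an even prefix residue (window-1 prefix law, ranks taken in all of S)
  have hW1 : ∀ k < m, (t'.val + j'.val * k) % p < n₁ →
      2 ∣ (t'.val + j'.val * k) % p - #((range m).filter fun i' => (t'.val + j'.val * i') % p < (t'.val + j'.val * k) % p) := by
    intro k hk hkn
    have hpre := hpre₁
    rw [prefixOK, decide_eq_true_eq] at hpre
    have hmem : (t'.val + j'.val * k) % p ∈ ((range m).filter fun k => (t'.val + j'.val * k) % p < n₁).image fun k => (t'.val + j'.val * k) % p :=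
      mem_image.2 ⟨k, mem_filter.2 ⟨mem_range.2 hk, hkn⟩, rfl⟩
    have h := hpre _ hmem
    have hcnt : #((((range m).filter fun k => (t'.val + j'.val * k) % p < n₁).image fun k => (t'.val + j'.val * k) % p).filter
        fun y => y < (t'.val + j'.val * k) % p) = #((range m).filter fun i' => (t'.val + j'.val * i') % p < (t'.val + j'.val * k) % p) := by
      rw [Finset.filter_image, Finset.card_image_of_injOn]
      · congr 1
        ext i'
        simp only [mem_filter, mem_range]
        constructor
        · rintro ⟨⟨hi, -⟩, hlt⟩; exact ⟨hi, hlt⟩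
        · rintro ⟨hi, hlt⟩; exact ⟨⟨hi, by omega⟩, hlt⟩
      · intro i₁ hi₁ i₂ hi₂ hii
        have him₁ := mem_range.1 (mem_filter.1 (mem_filter.1 (mem_coe.1 hi₁)).1).1
        have him₂ := mem_range.1 (mem_filter.1 (mem_filter.1 (mem_coe.1 hi₂)).1).1
        refine zmod_natMul_injOn (t := t') hj'0 (by omega) (by omega) ?_
        apply ZMod.val_injective p
        rw [hposval, hposval]; exact hii
    rw [hcnt] at h
    exact h
  have hW1L : ∀ x ∈ posList p m j'.val t'.val, x < n₁ → 2 ∣ x - ((posList p m j'.val t'.val).filter fun y => decide (y < x)).length := by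
    intro x hx hxn
    obtain ⟨k, hk, hkx⟩ := mem_posList.1 hx
    rw [length_filter_posList, ← card_filter_range_eq_length, ← hkx]
    exact hW1 k hk (by rw [hkx]; exact hxn)
  have hbmin : n₁ ≤ oddMinL p (n₁ + n₂) m (posList p m j'.val t'.val) := le_oddMinL (by omega) hW1L
  have hval := htable j'.val (ZMod.val_lt _) t'.val (ZMod.val_lt _) n₁ hn1 (by omega) hbmin hn1pos hpar hpre₁ s₂.val (ZMod.val_lt _) hcov hdisjN
    hn1I2 hendN (by rw [show n₁ + n₂ - n₁ = n₂ by omega]; exact hpre₂)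
  rw [hj'] at hval
  exact hval

end Transport

end Summit.MatrixMultiplication.OmegaCensus.CubeNB
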